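import Summits.QuantumFields.YangMills.Theorems.ColdStartUniversalityColdStartSolutionsExistVecPicardBounds
import HarnessLib

/-!
# Route `ColdStartUniversality`, support item S (stmt-QuantumFields-24811), line `piwiener`:
# vector Picard iteration IV — the limit process: a.s. locally uniform convergence, progressivity,
# `L²(sup)` convergence and square integrability

Helper file (lead `ym-line-csu-p1`) for stub A `stub_ambientStrongExistence`; port of the sections
`PicardLimit`, `PicardL2` and of `picardInv_picardLimit` of the tree's 1-D
`Literature/Analysis/FunctionSpaces/ItoProcessesProofs.lean` (Revuz–Yor IX (2.1), existence half) to Lipschitz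
systems driven by a Brownian vector (parts I–III).  The limit of a Picard sequence `X m` is the pointwise
`limUnder` process `(i, t, ω) ↦ limUnder atTop (fun m => X m i t ω)` (written out; no definition):

* `vecPicard_ae_tendsto_lim` — a.s. every coordinate of `X m` converges locally uniformly; the limit has
  continuous paths; `vecPicard_isStronglyProgressive_lim`, `vecPicard_lim_apply_zero`;
* `vecPicard_lintegral_iSup_sub_lim_le`, `vecPicard_tendsto_lintegral_iSup_sub_lim` —
  `E[sup_{s≤T} Σ_i (Xᵐ_i − X_i)²(s)] → 0` (and is finite);
* `vecPicard_lim_sqIntegrable` — the limit is `L²(sup)` on bounded intervals.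

No definition, no sorry.  RECORD-rung plumbing; nothing here bears on the Yang–Mills mass gap. -/

set_option autoImplicit false

noncomputable section

namespace Summit.QuantumFields.YangMills.Theorems.ColdStartUniversality

open MeasureTheory ProbabilityTheory Filter Topology Finset
open scoped NNReal ENNReal BigOperators
open Literature.Probability.Process Literature.Analysis.FunctionSpaces

variable {Ω : Type*} {mΩ : MeasurableSpace Ω} {P : Measure Ω} {d : ℕ}
  {W : ℝ≥0 → Ω → (Fin d → ℝ)} {ι κ : Type*} [Fintype ι] [Fintype κ]
  {b : (ι → ℝ) → ι → ℝ} {σ : (ι → ℝ) → ι → κ → ℝ} {c : ι → κ → Fin d} {K : ℝ} {x₀ : ι → ℝ}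

section Sequence

variable [IsProbabilityMeasure P] (hW : IsBrownianVec W P) (hK : 0 ≤ K)
  (hb : ∀ x y : ι → ℝ, ∑ i, (b x i - b y i) ^ 2 ≤ K * ∑ i, (x i - y i) ^ 2)
  (hσ : ∀ x y : ι → ℝ, ∑ i, ∑ n, (σ x i n - σ y i n) ^ 2 ≤ K * ∑ i, (x i - y i) ^ 2)
  {X : ℕ → ι → ℝ≥0 → Ω → ℝ} {JX : ℕ → ι → κ → ℝ≥0 → Ω → ℝ}
  (hX0 : ∀ i t ω, X 0 i t ω = x₀ i)
  (hXp : ∀ m i, IsStronglyProgressive hW.natFiltration (X m i))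
  (hXc : ∀ m, ∀ᵐ ω ∂P, ∀ i, Continuous fun t => X m i t ω)
  (hJX : ∀ m i n, IsItoIntegral (fun s ω => σ (fun j => X m j s ω) i n) (fun s ω => W s ω (c i n)) (JX m i n)
      hW.natFiltration P ∧ IsStronglyProgressive hW.natFiltration (JX m i n))
  (hXs : ∀ m i t ω, X (m + 1) i t ω =
      x₀ i + timeIntegral (fun s ω => b (fun j => X m j s ω) i) t ω + ∑ n, JX m i n t ω)

include hW hK hb hσ hX0 hXp hXc hJX hXs

/-- **Almost sure locally uniform convergence of the vector Picard scheme**: almost surely, every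
coordinate `X m i · ω` converges at every time to the `limUnder` process, which has continuous paths
(geometric increments `|Xᵐ_i − Xᵐ⁺¹_i| ≤ 2⁻ᵐ` on `[0, T]`, `tendstoUniformlyOn_of_geometric`).
Port of `ae_tendsto_picardLimit`. Revuz–Yor (1999), Ch. IX, proof of Thm (2.1). [folklore] -/
theorem vecPicard_ae_tendsto_lim :
    ∀ᵐ ω ∂P, (∀ i, Continuous fun t => limUnder atTop (fun m => X m i t ω)) ∧
      ∀ i s, Tendsto (fun m => X m i s ω) atTop (𝓝 (limUnder atTop (fun m => X m i s ω))) := by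
  have hcont : ∀ᵐ ω ∂P, ∀ m i, Continuous fun t => X m i t ω := by
    rw [ae_all_iff]; exact fun m => hXc m
  filter_upwards [vecPicard_ae_eventually_iSup_lt hW hK hb hσ hX0 hXp hXc hJX hXs, hcont] with ω hω hc'
  -- real form of the increment bound on `[0, T]`, per coordinate
  have hreal : ∀ (i : ι) (T : ℕ), ∀ᶠ m in atTop, ∀ s ∈ Set.Iic (T : ℝ≥0),
      |X m i s ω - X (m + 1) i s ω| ≤ (1 / 2) ^ m := by
    intro i T
    refine (hω T).mono fun m hm s hs => ?_
    have h1 := lt_of_le_of_lt (le_iSup₂_of_le s hs le_rfl) hm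
    have h4 : ((1 : ℝ≥0∞) / 4) ^ m = ENNReal.ofReal (((1 / 2 : ℝ) ^ m) ^ 2) := by
      have e1 : (((1 / 2 : ℝ) ^ m) ^ 2) = (1 / 4) ^ m := by
        rw [← pow_mul, mul_comm, pow_mul]; norm_num
      rw [e1, ENNReal.ofReal_pow (by norm_num), ENNReal.ofReal_div_of_pos (by norm_num),
        ENNReal.ofReal_one, ENNReal.ofReal_ofNat]
    rw [h4, ENNReal.ofReal_lt_ofReal_iff_of_nonneg (Finset.sum_nonneg fun _ _ => sq_nonneg _)] at h1
    have h2 : (X m i s ω - X (m + 1) i s ω) ^ 2 < ((1 / 2 : ℝ) ^ m) ^ 2 :=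
      lt_of_le_of_lt (vecPicard_sq_le_sum_sq (fun j => X m j s ω - X (m + 1) j s ω) i) h1
    have h3 := sq_lt_sq.1 h2
    rw [abs_of_pos (by positivity : (0 : ℝ) < (1 / 2) ^ m)] at h3
    exact h3.le
  have hconv := fun (i : ι) (T : ℕ) =>
    tendstoUniformlyOn_of_geometric (f := fun m s => X m i s ω) (hreal i T)
  refine ⟨fun i => ?_, fun i s => ?_⟩
  · have hT : ∀ T : ℕ, ContinuousOn (fun t => limUnder atTop (fun m => X m i t ω)) (Set.Iic (T : ℝ≥0)) :=
      fun T => (hconv i T).2.continuousOn (Eventually.of_forall fun m => (hc' m i).continuousOn).frequently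
    refine continuous_iff_continuousAt.2 fun t => ?_
    obtain ⟨T, hT'⟩ := exists_nat_gt t
    exact (hT T).continuousAt (Iic_mem_nhds hT')
  · obtain ⟨T, hT'⟩ := exists_nat_ge s
    exact (hconv i T).1 s hT'

omit [Fintype ι] [IsProbabilityMeasure P] hK hb hσ hX0 hXc hJX hXs in
/-- The limit process is coordinatewise progressive (pointwise `limUnder` of progressive processes).
Port of `isStronglyProgressive_picardLimit`. [folklore] -/
theorem vecPicard_isStronglyProgressive_lim (i : ι) :
    IsStronglyProgressive hW.natFiltration (fun t ω => limUnder atTop (fun m => X m i t ω)) := fun u =>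
  @MeasureTheory.StronglyMeasurable.limUnder ℕ (Set.Iic u × Ω) ℝ
    (Subtype.instMeasurableSpace.prod (hW.natFiltration u)) _ _ atTop _
    (fun m p => X m i p.1 p.2) _ _ (fun m => hXp m i u)

omit [Fintype ι] [IsProbabilityMeasure P] hK hb hσ hXp hXc in
/-- Every Picard iterate, hence the limit, starts at `x₀`. [folklore] -/
theorem vecPicard_lim_apply_zero (i : ι) (ω : Ω) : limUnder atTop (fun m => X m i 0 ω) = x₀ i := by
  have h : ∀ m, X m i 0 ω = x₀ i := by
    intro m
    cases m with
    | zero => exact hX0 i 0 ω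
    | succ m =>
      rw [hXs m i 0 ω, timeIntegral_apply_zero]
      simp [(hJX m i _).1.apply_zero ω]
  simp only [h]
  exact tendsto_const_nhds.limUnder_eq

/-- **`L²(sup)` convergence of the vector Picard scheme to its limit**:
`E[sup_{s≤T} Σ_i (Xᵐ_i(s) − X_i(s))²] ≤ |ι| · 2·2⁻ᵐ · D e^{16cT} (1 − 1/8)⁻¹`. Port of
`lintegral_iSup_picard_sub_limit_sq_le` (weighted Cauchy–Schwarz on the telescoping sum, coordinatewise).
Revuz–Yor (1999), Ch. IX, proof of Thm (2.1). [folklore] -/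
theorem vecPicard_lintegral_iSup_sub_lim_le (T : ℝ≥0) (m : ℕ) :
    ∫⁻ ω, ⨆ s ∈ Set.Iic T, ENNReal.ofReal
        (∑ i, (X m i s ω - limUnder atTop (fun k => X k i s ω)) ^ 2) ∂P ≤
      (Fintype.card ι : ℝ≥0∞) * (ENNReal.ofReal (2 * (1 / 2) ^ m) *
        ((∫⁻ ω, ⨆ s ∈ Set.Iic T, ENNReal.ofReal (∑ i, (X 0 i s ω - X 1 i s ω) ^ 2) ∂P) *
          ENNReal.ofReal (Real.exp (16 * (((Fintype.card ι : ℝ) * (2 * T * K) +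
            8 * (Fintype.card ι : ℝ) * (Fintype.card κ : ℝ) ^ 2 * K) * T))) * (1 - 1 / 8)⁻¹)) := by
  -- the tail series, per path
  set S : Ω → ℝ≥0∞ := fun ω => ∑' k, (if m ≤ k then 2 ^ k * ⨆ r ∈ Set.Iic T,
    ENNReal.ofReal (∑ i, (X k i r ω - X (k + 1) i r ω) ^ 2) else 0) with hSdef
  -- pathwise bound, a.e.
  have hpt : ∀ᵐ ω ∂P, ⨆ s ∈ Set.Iic T, ENNReal.ofReal
      (∑ i, (X m i s ω - limUnder atTop (fun k => X k i s ω)) ^ 2) ≤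
      (Fintype.card ι : ℝ≥0∞) * (ENNReal.ofReal (2 * (1 / 2) ^ m) * S ω) := by
    filter_upwards [vecPicard_ae_tendsto_lim hW hK hb hσ hX0 hXp hXc hJX hXs] with ω hω
    refine iSup₂_le fun s hs => ?_
    rw [ENNReal.ofReal_sum_of_nonneg fun i _ => sq_nonneg _]
    calc ∑ i, ENNReal.ofReal ((X m i s ω - limUnder atTop (fun k => X k i s ω)) ^ 2)
        ≤ ∑ _i : ι, ENNReal.ofReal (2 * (1 / 2) ^ m) * S ω := by
          refine Finset.sum_le_sum fun i _ => ?_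
          have h := ofReal_picard_sub_limit_sq_le (f := fun k s => X k i s ω)
            (g := fun s => limUnder atTop (fun k => X k i s ω)) (T := T) (Set.mem_Iic.1 hs) (hω.2 i s) m
          refine h.trans (mul_le_mul' le_rfl (ENNReal.tsum_le_tsum fun k => ?_))
          by_cases hk : m ≤ k
          · simp only [if_pos hk]
            refine mul_le_mul' le_rfl (iSup₂_le fun r hr => ?_)
            exact (ENNReal.ofReal_le_ofReal (vecPicard_sq_le_sum_sq (fun j => X k j r ω - X (k + 1) j r ω) i)).trans
              (le_iSup₂_of_le r hr le_rfl)
          · simp only [if_neg hk]; exact le_rfl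
      _ = (Fintype.card ι : ℝ≥0∞) * (ENNReal.ofReal (2 * (1 / 2) ^ m) * S ω) := by
          rw [Finset.sum_const, Finset.card_univ, nsmul_eq_mul]
  -- a.e. measurability of the terms
  have hmeasD : ∀ k, AEMeasurable (fun ω => ⨆ r ∈ Set.Iic T,
      ENNReal.ofReal (∑ i, (X k i r ω - X (k + 1) i r ω) ^ 2)) P := fun k =>
    vecPicard_aemeasurable_biSup (hXp k) (hXp (k + 1)) (hXc k) (hXc (k + 1)) T
  have hmeas : ∀ k, AEMeasurable (fun ω => if m ≤ k then 2 ^ k * ⨆ r ∈ Set.Iic T,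
      ENNReal.ofReal (∑ i, (X k i r ω - X (k + 1) i r ω) ^ 2) else 0) P := by
    intro k
    by_cases hk : m ≤ k
    · simp only [if_pos hk]; exact (hmeasD k).const_mul _
    · simp only [if_neg hk]; exact aemeasurable_const
  -- term-wise integrals
  set D' : ℝ≥0∞ := (∫⁻ ω, ⨆ s ∈ Set.Iic T, ENNReal.ofReal (∑ i, (X 0 i s ω - X 1 i s ω) ^ 2) ∂P) *
    ENNReal.ofReal (Real.exp (16 * (((Fintype.card ι : ℝ) * (2 * T * K) +
      8 * (Fintype.card ι : ℝ) * (Fintype.card κ : ℝ) ^ 2 * K) * T))) with hD'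
  have hterm : ∀ k, ∫⁻ ω, (if m ≤ k then 2 ^ k * ⨆ r ∈ Set.Iic T,
      ENNReal.ofReal (∑ i, (X k i r ω - X (k + 1) i r ω) ^ 2) else 0) ∂P ≤ 2 ^ k * (D' * (1 / 16) ^ k) := by
    intro k
    by_cases hk : m ≤ k
    · simp only [if_pos hk]
      rw [lintegral_const_mul'' _ (hmeasD k)]
      exact mul_le_mul' le_rfl (vecPicard_dist_le_geometric hW hK hb hσ hXp hXc hJX hXs T k)
    · simp only [if_neg hk, lintegral_const, zero_mul]
      exact bot_le
  have hS : ∫⁻ ω, S ω ∂P ≤ D' * (1 - 1 / 8)⁻¹ := by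
    simp only [hSdef]
    rw [lintegral_tsum hmeas]
    calc ∑' k, ∫⁻ ω, (if m ≤ k then 2 ^ k * ⨆ r ∈ Set.Iic T,
          ENNReal.ofReal (∑ i, (X k i r ω - X (k + 1) i r ω) ^ 2) else 0) ∂P
        ≤ ∑' k : ℕ, 2 ^ k * (D' * (1 / 16) ^ k) := ENNReal.tsum_le_tsum hterm
      _ = D' * (1 - 1 / 8)⁻¹ := by
          have h8 : ∀ k : ℕ, (2 : ℝ≥0∞) ^ k * (1 / 16) ^ k = (1 / 8) ^ k := by
            intro k
            rw [← mul_pow]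
            congr 1
            rw [show (16 : ℝ≥0∞) = 2 * 8 by norm_num, one_div, one_div,
              ENNReal.mul_inv (Or.inl (by norm_num)) (Or.inl (by norm_num)), ← mul_assoc,
              ENNReal.mul_inv_cancel (by norm_num) (by norm_num), one_mul]
          simp_rw [show ∀ k : ℕ, (2 : ℝ≥0∞) ^ k * (D' * (1 / 16) ^ k) = D' * ((2 : ℝ≥0∞) ^ k * (1 / 16) ^ k)
            from fun k => by ring, h8, ENNReal.tsum_mul_left, ENNReal.tsum_geometric]
  calc _ ≤ ∫⁻ ω, (Fintype.card ι : ℝ≥0∞) * (ENNReal.ofReal (2 * (1 / 2) ^ m) * S ω) ∂P := lintegral_mono_ae hpt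
    _ = (Fintype.card ι : ℝ≥0∞) * (ENNReal.ofReal (2 * (1 / 2) ^ m) * ∫⁻ ω, S ω ∂P) := by
        rw [lintegral_const_mul'' _ ((AEMeasurable.tsum hmeas).const_mul _),
          lintegral_const_mul'' _ (AEMeasurable.tsum hmeas)]
    _ ≤ _ := by gcongr

/-- The `L²(sup)` distance between the Picard iterates and the limit is finite and tends to `0`.
Port of `tendsto_lintegral_iSup_picard_sub_limit_sq`. [folklore] -/
theorem vecPicard_tendsto_lintegral_iSup_sub_lim (T : ℝ≥0) :
    Tendsto (fun m => ∫⁻ ω, ⨆ s ∈ Set.Iic T, ENNReal.ofReal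
        (∑ i, (X m i s ω - limUnder atTop (fun k => X k i s ω)) ^ 2) ∂P) atTop (𝓝 0) ∧
    ∀ m, ∫⁻ ω, ⨆ s ∈ Set.Iic T, ENNReal.ofReal
        (∑ i, (X m i s ω - limUnder atTop (fun k => X k i s ω)) ^ 2) ∂P < ∞ := by
  set M : ℝ≥0∞ := (Fintype.card ι : ℝ≥0∞) *
    (((∫⁻ ω, ⨆ s ∈ Set.Iic T, ENNReal.ofReal (∑ i, (X 0 i s ω - X 1 i s ω) ^ 2) ∂P) *
      ENNReal.ofReal (Real.exp (16 * (((Fintype.card ι : ℝ) * (2 * T * K) +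
        8 * (Fintype.card ι : ℝ) * (Fintype.card κ : ℝ) ^ 2 * K) * T))) * (1 - 1 / 8)⁻¹)) with hM
  have hMfin : M ≠ ∞ := by
    refine ENNReal.mul_ne_top (by simp) (ENNReal.mul_ne_top (ENNReal.mul_ne_top
      (vecPicard_dist_zero_lt_top hW hK hσ hX0 hJX hXs T).ne ENNReal.ofReal_ne_top) (ENNReal.inv_ne_top.2 ?_))
    exact (tsub_pos_iff_lt.2 (by norm_num)).ne'
  have hb' : ∀ m, ∫⁻ ω, ⨆ s ∈ Set.Iic T, ENNReal.ofReal
      (∑ i, (X m i s ω - limUnder atTop (fun k => X k i s ω)) ^ 2) ∂P ≤ ENNReal.ofReal (2 * (1 / 2) ^ m) * M := by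
    intro m
    refine (vecPicard_lintegral_iSup_sub_lim_le hW hK hb hσ hX0 hXp hXc hJX hXs T m).trans_eq ?_
    simp only [hM]; ring
  refine ⟨?_, fun m => (hb' m).trans_lt (ENNReal.mul_lt_top ENNReal.ofReal_lt_top hMfin.lt_top)⟩
  have h0 : Tendsto (fun m : ℕ => ENNReal.ofReal (2 * (1 / 2) ^ m) * M) atTop (𝓝 0) := by
    have h1 : Tendsto (fun m : ℕ => (2 : ℝ) * (1 / 2) ^ m) atTop (𝓝 0) := by
      simpa using (tendsto_pow_atTop_nhds_zero_of_lt_one (r := (1 / 2 : ℝ)) (by norm_num)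
        (by norm_num)).const_mul 2
    have h2 : Tendsto (fun m : ℕ => ENNReal.ofReal (2 * (1 / 2) ^ m)) atTop (𝓝 0) := by
      simpa using ENNReal.tendsto_ofReal h1
    simpa using ENNReal.Tendsto.mul_const h2 (Or.inr hMfin)
  exact tendsto_of_tendsto_of_tendsto_of_le_of_le tendsto_const_nhds h0 (fun m => bot_le) hb'

omit hK hb hσ hXs hJX in
/-- **The limit is `L²(sup)`** on bounded intervals (`Σ X² ≤ 2Σ(X⁰)² + 2Σ(X⁰ − X)²`), given the
finiteness of `E[sup Σ(X⁰ − X)²]`. Port of `picardInv_picardLimit` (third clause). [folklore] -/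
theorem vecPicard_lim_sqIntegrable_of (t : ℝ≥0)
    (hlimc : ∀ᵐ ω ∂P, ∀ i, Continuous fun t => limUnder atTop (fun m => X m i t ω))
    (hfin : ∫⁻ ω, ⨆ s ∈ Set.Iic t, ENNReal.ofReal
        (∑ i, (X 0 i s ω - limUnder atTop (fun k => X k i s ω)) ^ 2) ∂P < ∞) :
    ∫⁻ ω, ⨆ s ∈ Set.Iic t, ENNReal.ofReal (∑ i, (limUnder atTop (fun m => X m i s ω)) ^ 2) ∂P < ∞ := by
  have hpt : ∀ ω, ⨆ s ∈ Set.Iic t, ENNReal.ofReal (∑ i, (limUnder atTop (fun m => X m i s ω)) ^ 2) ≤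
      2 * ENNReal.ofReal (∑ i, x₀ i ^ 2) +
      2 * ⨆ s ∈ Set.Iic t, ENNReal.ofReal (∑ i, (X 0 i s ω - limUnder atTop (fun k => X k i s ω)) ^ 2) := by
    intro ω
    refine iSup₂_le fun s hs => ?_
    have hle : ∑ i, (limUnder atTop (fun m => X m i s ω)) ^ 2 ≤
        2 * ∑ i, x₀ i ^ 2 + 2 * ∑ i, (X 0 i s ω - limUnder atTop (fun k => X k i s ω)) ^ 2 := by
      rw [Finset.mul_sum, Finset.mul_sum, ← Finset.sum_add_distrib]
      refine Finset.sum_le_sum fun i _ => ?_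
      rw [hX0 i s ω]
      nlinarith [sq_nonneg (x₀ i + (x₀ i - limUnder atTop (fun k => X k i s ω)))]
    calc ENNReal.ofReal (∑ i, (limUnder atTop (fun m => X m i s ω)) ^ 2)
        ≤ ENNReal.ofReal (2 * ∑ i, x₀ i ^ 2 + 2 * ∑ i, (X 0 i s ω - limUnder atTop (fun k => X k i s ω)) ^ 2) :=
          ENNReal.ofReal_le_ofReal hle
      _ = 2 * ENNReal.ofReal (∑ i, x₀ i ^ 2) +
            2 * ENNReal.ofReal (∑ i, (X 0 i s ω - limUnder atTop (fun k => X k i s ω)) ^ 2) := by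
          rw [ENNReal.ofReal_add (by positivity) (by positivity), ENNReal.ofReal_mul (by norm_num),
            ENNReal.ofReal_mul (by norm_num), ENNReal.ofReal_ofNat]
      _ ≤ _ := by
          gcongr
          exact le_iSup₂_of_le s hs le_rfl
  calc ∫⁻ ω, ⨆ s ∈ Set.Iic t, ENNReal.ofReal (∑ i, (limUnder atTop (fun m => X m i s ω)) ^ 2) ∂P
      ≤ ∫⁻ ω, (2 * ENNReal.ofReal (∑ i, x₀ i ^ 2) +
          2 * ⨆ s ∈ Set.Iic t, ENNReal.ofReal (∑ i, (X 0 i s ω - limUnder atTop (fun k => X k i s ω)) ^ 2)) ∂P :=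
        lintegral_mono hpt
    _ = 2 * ENNReal.ofReal (∑ i, x₀ i ^ 2) * P Set.univ +
          2 * ∫⁻ ω, ⨆ s ∈ Set.Iic t, ENNReal.ofReal
            (∑ i, (X 0 i s ω - limUnder atTop (fun k => X k i s ω)) ^ 2) ∂P := by
        rw [lintegral_add_left measurable_const, lintegral_const,
          lintegral_const_mul'' _ (vecPicard_aemeasurable_biSup (hXp 0)
            (fun i => vecPicard_isStronglyProgressive_lim hW hXp i) (hXc 0) hlimc t)]
    _ < ⊤ := ENNReal.add_lt_top.2 ⟨ENNReal.mul_lt_top (ENNReal.mul_lt_top (by norm_num) ENNReal.ofReal_lt_top)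
        (measure_lt_top _ _), ENNReal.mul_lt_top (by norm_num) hfin⟩

/-- **The limit of the Picard scheme is `L²(sup)`** on bounded intervals. [folklore] -/
theorem vecPicard_lim_sqIntegrable (t : ℝ≥0) :
    ∫⁻ ω, ⨆ s ∈ Set.Iic t, ENNReal.ofReal (∑ i, (limUnder atTop (fun m => X m i s ω)) ^ 2) ∂P < ∞ :=
  vecPicard_lim_sqIntegrable_of hW hX0 hXp hXc t
    ((vecPicard_ae_tendsto_lim hW hK hb hσ hX0 hXp hXc hJX hXs).mono fun _ h => h.1)
    ((vecPicard_tendsto_lintegral_iSup_sub_lim hW hK hb hσ hX0 hXp hXc hJX hXs t).2 0)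

end Sequence

end Summit.QuantumFields.YangMills.Theorems.ColdStartUniversality

end
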